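import Literature.Computability.Complexity.SymmetricCircuit
import Literature.Computability.Complexity.CircuitDAG
import Literature.Computability.Complexity.CircuitRestriction
import HarnessLib

/-!
# The symmetric DNF: every invariant function has a symmetric circuit (of exponential size)

For a set `Γ` of permutations of `Fin m` acting diagonally on `m × m` Boolean matrices and a
`Γ`-invariant `f : (Fin m × Fin m → Bool) → Bool`, the canonical disjunctive normal form of `f` —
one `¬` gate per variable, one `∧` gate (over all `m²` literals) per satisfying assignment, one
`∨` gate — is a `Γ`-symmetric circuit in the sense of Anderson–Dawar / Dawar–Wilsenach
(`Circuit.IsSymmetricUnder`, `SymmetricCircuit.lean`): `ρ ∈ Γ` acts on the `¬` gates through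
`ρ × ρ` and on the `∧` gates through its action `a ↦ a ∘ (ρ × ρ)⁻¹` on satisfying assignments
(which it permutes, by invariance), fixing the `∨` gate. Hence (`hasSymCircuit_of_invariant`)

  `HasSymCircuit tcBasis Γ (2 ^ (m * m) + m * m + 1) f` for every `Γ`-invariant `f`,

so `HasSymCircuit`/`symCircuitSizeOver` are never vacuous on invariant functions, and statements
"for every polynomial `p`, (frequently) no `Γ`-symmetric circuit of size `≤ p m`" may freely trade
`∃ m` for `∃ᶠ m` by padding. This is the trivial upper bound implicit in the symmetric-circuit
literature (Anderson–Dawar 2017, §2.2–§3: symmetric circuits decide exactly the invariant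
properties, the question being SIZE); the construction is written on the tree's labelled DAGs
(`GateDAG`, `CircuitDAG.lean`) and compiled to a straight-line `Circuit` by `GateDAG.compile`
(`compile_eval`, `compile_isOver`, `isSymmetricUnder_compile_iff`). Everything is proved; no
named facts.

## References

* M. Anderson, A. Dawar, *On symmetric circuits and fixed-point logics*, Theory Comput. Syst. 60
  (2017), §2.2 (symmetric circuits, invariance) [AndersonDawar2016].
* A. Dawar, G. Wilsenach, *Symmetric arithmetic circuits*, Theory of Computing 21 (2025), §3
  [DawarWilsenach2025].
* S. Jukna, *Boolean Function Complexity* (2012), §1.1 Eq. (1.1) (the canonical DNF) [Jukna2012].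
-/

namespace Literature.Computability.Complexity

namespace SymmetricDnf

variable {m : ℕ}

/-- The diagonal permutation of matrix positions induced by a vertex permutation. [folklore] -/
def diagPerm (ρ : Equiv.Perm (Fin m)) : Equiv.Perm (Fin m × Fin m) := Equiv.prodCongr ρ ρ

/-- `diagPerm ρ` acts by `(u, v) ↦ (ρ u, ρ v)`. [folklore] -/
@[simp] theorem diagPerm_apply (ρ : Equiv.Perm (Fin m)) (q : Fin m × Fin m) :
    diagPerm ρ q = (ρ q.1, ρ q.2) := rfl

/-- Gate type of the symmetric DNF: one `¬` gate per variable, one `∧` gate per satisfying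
assignment, one `∨` gate. [folklore] -/
abbrev DnfGate (m : ℕ) (f : (Fin m × Fin m → Bool) → Bool) : Type :=
  (Fin m × Fin m) ⊕ {a : Fin m × Fin m → Bool // f a = true} ⊕ Unit

/-- An enumeration of the variables. [folklore] -/
noncomputable def varEquiv (m : ℕ) : Fin (Fintype.card (Fin m × Fin m)) ≃ Fin m × Fin m :=
  (Fintype.equivFin _).symm

/-- An enumeration of the satisfying assignments. [folklore] -/
noncomputable def satEquiv (f : (Fin m × Fin m → Bool) → Bool) :
    Fin (Fintype.card {a : Fin m × Fin m → Bool // f a = true}) ≃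
      {a : Fin m × Fin m → Bool // f a = true} :=
  (Fintype.equivFin _).symm

/-- Gate functions of the DNF. [folklore] -/
def dnfFn (f : (Fin m × Fin m → Bool) → Bool) : DnfGate m f → GateFn
  | Sum.inl _ => GateFn.not
  | Sum.inr (Sum.inl _) => GateFn.and (Fintype.card (Fin m × Fin m))
  | Sum.inr (Sum.inr _) => GateFn.or (Fintype.card {a : Fin m × Fin m → Bool // f a = true})

/-- Wires of the DNF. [folklore] -/
noncomputable def dnfArgs (f : (Fin m × Fin m → Bool) → Bool) :
    (l : DnfGate m f) → Fin (dnfFn f l).1 → (Fin m × Fin m) ⊕ DnfGate m f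
  | Sum.inl q => fun _ => Sum.inl q
  | Sum.inr (Sum.inl a) => fun k =>
      if a.1 (varEquiv m k) = true then Sum.inl (varEquiv m k)
      else Sum.inr (Sum.inl (varEquiv m k))
  | Sum.inr (Sum.inr _) => fun l => Sum.inr (Sum.inr (Sum.inl (satEquiv f l)))

/-- The canonical DNF of `f` as a labelled DAG. [folklore] -/
noncomputable def dnfDAG (f : (Fin m × Fin m → Bool) → Bool) :
    GateDAG (Fin m × Fin m) (DnfGate m f) where
  fn := dnfFn f
  args := dnfArgs f
  out := Sum.inr (Sum.inr (Sum.inr ()))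
  wf := by
    let rank : DnfGate m f → ℕ := Sum.elim (fun _ => 0) (Sum.elim (fun _ => 1) (fun _ => 2))
    refine Subrelation.wf (r := InvImage (· < ·) rank) ?_ (InvImage.wf rank Nat.lt_wfRel.wf)
    intro l' l ⟨a, ha⟩
    rcases l with q | a₀ | u
    · exact absurd ha Sum.inl_ne_inr
    · change (if a₀.1 (varEquiv m a) = true then Sum.inl (varEquiv m a)
        else Sum.inr (Sum.inl (varEquiv m a))) = Sum.inr l' at ha
      split_ifs at ha with h
      cases ha
      exact Nat.zero_lt_one
    · change (Sum.inr (Sum.inr (Sum.inl (satEquiv f a))) : (Fin m × Fin m) ⊕ DnfGate m f) =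
        Sum.inr l' at ha
      cases ha
      exact Nat.lt_succ_self 1

/-! #### Semantics -/

/-- The `¬` gate of variable `q` computes `¬ x q`. [folklore] -/
theorem dnfDAG_val_not (f : (Fin m × Fin m → Bool) → Bool) (x : Fin m × Fin m → Bool)
    (q : Fin m × Fin m) : (dnfDAG f).val x (Sum.inl q) = !(x q) := by
  rw [GateDAG.val_eq]; rfl

/-- The `∧` gate of the satisfying assignment `a` computes the minterm `[x = a]`. [folklore] -/
theorem dnfDAG_val_and (f : (Fin m × Fin m → Bool) → Bool) (x : Fin m × Fin m → Bool)
    (a : {a : Fin m × Fin m → Bool // f a = true}) :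
    (dnfDAG f).val x (Sum.inr (Sum.inl a)) = decide (x = a.1) := by
  rw [GateDAG.val_eq]
  change decide (∀ k, GateDAG.wire x ((dnfDAG f).val x)
      (if a.1 (varEquiv m k) = true then Sum.inl (varEquiv m k)
        else Sum.inr (Sum.inl (varEquiv m k))) = true) = decide (x = a.1)
  refine decide_eq_decide.2 ⟨fun h => funext fun q => ?_, fun h k => ?_⟩
  · have hk := h ((varEquiv m).symm q)
    rw [Equiv.apply_symm_apply] at hk
    by_cases ha : a.1 q = true
    · rw [if_pos ha, GateDAG.wire_inl] at hk
      rw [hk, ha]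
    · rw [if_neg ha, GateDAG.wire_inr, dnfDAG_val_not] at hk
      rw [Bool.not_eq_true] at ha
      rw [ha]
      simpa using hk
  · subst h
    by_cases ha : a.1 (varEquiv m k) = true
    · rw [if_pos ha, GateDAG.wire_inl, ha]
    · rw [if_neg ha, GateDAG.wire_inr, dnfDAG_val_not]
      simpa using ha

/-- The `∨` gate computes `f` (Jukna 2012, §1.1 Eq. (1.1): `f = ⋁_{a ∈ f⁻¹(1)} [x = a]`). [cite: Jukna2012, §1.1 Eq. (1.1)] -/
theorem dnfDAG_val_or (f : (Fin m × Fin m → Bool) → Bool) (x : Fin m × Fin m → Bool) :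
    (dnfDAG f).val x (Sum.inr (Sum.inr ())) = f x := by
  rw [GateDAG.val_eq]
  change decide (∃ l, GateDAG.wire x ((dnfDAG f).val x)
      (Sum.inr (Sum.inr (Sum.inl (satEquiv f l)))) = true) = f x
  simp only [GateDAG.wire_inr, dnfDAG_val_and, decide_eq_true_eq]
  cases hfx : f x
  · rw [decide_eq_false_iff_not]
    rintro ⟨l, hl⟩
    have := (satEquiv f l).2
    rw [← hl, hfx] at this
    exact Bool.false_ne_true this
  · rw [decide_eq_true_iff]
    exact ⟨(satEquiv f).symm ⟨x, hfx⟩, by simp⟩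

/-- The DNF computes `f` at its output wire. [folklore] -/
theorem dnfDAG_evalOut (f : (Fin m × Fin m → Bool) → Bool) (x : Fin m × Fin m → Bool) :
    (dnfDAG f).evalOut x = f x :=
  dnfDAG_val_or f x

/-! #### Basis and size -/

/-- All gates of the DNF are in `acBasis ⊆ tcBasis`. [folklore] -/
theorem dnfDAG_fn_mem (f : (Fin m × Fin m → Bool) → Bool) (l : DnfGate m f) :
    (dnfDAG f).fn l ∈ tcBasis := by
  refine acBasis_subset_tcBasis ?_
  rcases l with q | a | u
  · exact Or.inl rfl
  · exact and_mem_acBasis _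
  · exact or_mem_acBasis _

/-- The DNF has at most `2^(m²) + m² + 1` gates. [folklore] -/
theorem card_dnfGate_le (f : (Fin m × Fin m → Bool) → Bool) :
    Fintype.card (DnfGate m f) ≤ 2 ^ (m * m) + m * m + 1 := by
  have h1 : Fintype.card (Fin m × Fin m) = m * m := by simp
  have h2 : Fintype.card {a : Fin m × Fin m → Bool // f a = true} ≤ 2 ^ (m * m) := by
    refine (Fintype.card_subtype_le _).trans ?_
    rw [Fintype.card_fun, Fintype.card_bool, h1]
  simp only [Fintype.card_sum, Fintype.card_unit, h1]
  omega

/-! #### Symmetry -/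

/-- The action of a vertex permutation on satisfying assignments of an invariant `f`. [folklore] -/
noncomputable def satPerm (f : (Fin m × Fin m → Bool) → Bool) (ρ : Equiv.Perm (Fin m))
    (hinv : ∀ x : Fin m × Fin m → Bool, f (fun q => x (ρ q.1, ρ q.2)) = f x) :
    Equiv.Perm {a : Fin m × Fin m → Bool // f a = true} where
  toFun a := ⟨a.1 ∘ (diagPerm ρ).symm, by
    have h := hinv (a.1 ∘ (diagPerm ρ).symm)
    have : (fun q => (a.1 ∘ ⇑(diagPerm ρ).symm) (ρ q.1, ρ q.2)) = a.1 := by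
      funext q
      show a.1 ((diagPerm ρ).symm (diagPerm ρ q)) = a.1 q
      rw [Equiv.symm_apply_apply]
    rw [this] at h
    rw [← h]; exact a.2⟩
  invFun a := ⟨a.1 ∘ diagPerm ρ, by
    have h := hinv a.1
    exact h.trans a.2⟩
  left_inv a := by
    ext q
    show a.1 ((diagPerm ρ).symm (diagPerm ρ q)) = a.1 q
    rw [Equiv.symm_apply_apply]
  right_inv a := by
    ext q
    show a.1 (diagPerm ρ ((diagPerm ρ).symm q)) = a.1 q
    rw [Equiv.apply_symm_apply]

/-- `satPerm` acts by `a ↦ a ∘ (ρ × ρ)⁻¹`. [folklore] -/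
@[simp] theorem satPerm_apply_val (f : (Fin m × Fin m → Bool) → Bool) (ρ : Equiv.Perm (Fin m))
    (hinv : ∀ x : Fin m × Fin m → Bool, f (fun q => x (ρ q.1, ρ q.2)) = f x)
    (a : {a : Fin m × Fin m → Bool // f a = true}) (q : Fin m × Fin m) :
    (satPerm f ρ hinv a).1 q = a.1 ((diagPerm ρ).symm q) := rfl

/-- The gate bijection extending `ρ`: variables by `ρ × ρ`, `∧` gates by the action on
assignments, the `∨` gate fixed. [folklore] -/
noncomputable def dnfAut (f : (Fin m × Fin m → Bool) → Bool) (ρ : Equiv.Perm (Fin m))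
    (hinv : ∀ x : Fin m × Fin m → Bool, f (fun q => x (ρ q.1, ρ q.2)) = f x) :
    DnfGate m f ≃ DnfGate m f :=
  Equiv.sumCongr (diagPerm ρ) (Equiv.sumCongr (satPerm f ρ hinv) (Equiv.refl Unit))

/-- `dnfAut f ρ` is an automorphism of the DNF over `ρ × ρ` (Anderson–Dawar 2017, Def. 6). [cite: AndersonDawar2016, Def. 6] -/
theorem dnfDAG_isAut (f : (Fin m × Fin m → Bool) → Bool) (ρ : Equiv.Perm (Fin m))
    (hinv : ∀ x : Fin m × Fin m → Bool, f (fun q => x (ρ q.1, ρ q.2)) = f x) :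
    (dnfDAG f).IsAut (fun q : Fin m × Fin m => (ρ q.1, ρ q.2)) (dnfAut f ρ hinv) := by
  refine ⟨rfl, ?_, ?_⟩
  · rintro (q | a | u) <;> rfl
  · rintro (q | a | u)
    · -- `¬` gate of `q` ↦ `¬` gate of `ρ q`
      show (List.ofFn fun _ : Fin 1 => (Sum.inl (diagPerm ρ q) : (Fin m × Fin m) ⊕ DnfGate m f)).Perm
        ((List.ofFn fun _ : Fin 1 => (Sum.inl q : (Fin m × Fin m) ⊕ DnfGate m f)).map
          (Sum.map (fun q : Fin m × Fin m => (ρ q.1, ρ q.2)) (dnfAut f ρ hinv)))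
      rw [List.map_ofFn]
      exact List.Perm.refl _
    · -- `∧` gate of `a` ↦ `∧` gate of `a ∘ (ρ×ρ)⁻¹`; arguments re-indexed by `τ`
      let e := varEquiv m
      let a' := satPerm f ρ hinv a
      let G : Fin (Fintype.card (Fin m × Fin m)) → (Fin m × Fin m) ⊕ DnfGate m f := fun j =>
        if a'.1 (e j) = true then Sum.inl (e j) else Sum.inr (Sum.inl (e j))
      let τ : Equiv.Perm (Fin (Fintype.card (Fin m × Fin m))) :=
        e.trans ((diagPerm ρ).trans e.symm)
      show (List.ofFn G).Perm ((List.ofFn fun k =>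
          if a.1 (e k) = true then (Sum.inl (e k) : (Fin m × Fin m) ⊕ DnfGate m f)
          else Sum.inr (Sum.inl (e k))).map
            (Sum.map (fun q : Fin m × Fin m => (ρ q.1, ρ q.2)) (dnfAut f ρ hinv)))
      rw [List.map_ofFn]
      have hfun : (Sum.map (fun q : Fin m × Fin m => (ρ q.1, ρ q.2)) ⇑(dnfAut f ρ hinv)) ∘
          (fun k => if a.1 (e k) = true then (Sum.inl (e k) : (Fin m × Fin m) ⊕ DnfGate m f)
            else Sum.inr (Sum.inl (e k))) = G ∘ τ := by
        funext k
        have hτ : e (τ k) = diagPerm ρ (e k) := by simp [τ]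
        have ha' : a'.1 (diagPerm ρ (e k)) = a.1 (e k) := by
          rw [satPerm_apply_val, Equiv.symm_apply_apply]
        simp only [Function.comp_apply, G, hτ, ha']
        by_cases h : a.1 (e k) = true
        · rw [if_pos h, if_pos h]; rfl
        · rw [if_neg h, if_neg h]; rfl
      rw [hfun]
      exact (Equiv.Perm.ofFn_comp_perm τ G).symm
    · -- the `∨` gate is fixed; its arguments are permuted by the action on assignments
      let eS := satEquiv f
      let H : Fin (Fintype.card {a : Fin m × Fin m → Bool // f a = true}) →
          (Fin m × Fin m) ⊕ DnfGate m f := fun l => Sum.inr (Sum.inr (Sum.inl (eS l)))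
      let τ : Equiv.Perm (Fin (Fintype.card {a : Fin m × Fin m → Bool // f a = true})) :=
        eS.trans ((satPerm f ρ hinv).trans eS.symm)
      show (List.ofFn H).Perm ((List.ofFn H).map
        (Sum.map (fun q : Fin m × Fin m => (ρ q.1, ρ q.2)) (dnfAut f ρ hinv)))
      rw [List.map_ofFn]
      have hfun : (Sum.map (fun q : Fin m × Fin m => (ρ q.1, ρ q.2)) ⇑(dnfAut f ρ hinv)) ∘ H =
          H ∘ τ := by
        funext l
        simp [H, τ, dnfAut]
      rw [hfun]
      exact (Equiv.Perm.ofFn_comp_perm τ H).symm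

/-- The DNF of a `Γ`-invariant function is `Γ`-symmetric (as a DAG). [folklore] -/
theorem dnfDAG_isSymm (f : (Fin m × Fin m → Bool) → Bool) (Γ : Set (Equiv.Perm (Fin m)))
    (hinv : ∀ ρ ∈ Γ, ∀ x : Fin m × Fin m → Bool, f (fun q => x (ρ q.1, ρ q.2)) = f x) :
    (dnfDAG f).IsSymm (GateDAG.diagMaps Γ) := by
  rintro π ⟨ρ, hρ, rfl⟩
  exact ⟨dnfAut f ρ (hinv ρ hρ), dnfDAG_isAut f ρ (hinv ρ hρ)⟩

/-- **Symmetric DNF.** Every `Γ`-invariant Boolean function of an `m × m` matrix has a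
`Γ`-symmetric threshold circuit (indeed an `{¬, ∧, ∨}`-circuit) with at most `2^(m²) + m² + 1`
gates: the canonical DNF, on which `ρ ∈ Γ` acts by permuting variables and minterms. Hence
`HasSymCircuit` is never vacuous for invariant functions, at exponential size. [folklore] -/
theorem hasSymCircuit_of_invariant (f : (Fin m × Fin m → Bool) → Bool)
    (Γ : Set (Equiv.Perm (Fin m)))
    (hinv : ∀ ρ ∈ Γ, ∀ x : Fin m × Fin m → Bool, f (fun q => x (ρ q.1, ρ q.2)) = f x) :
    HasSymCircuit tcBasis Γ (2 ^ (m * m) + m * m + 1) f := by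
  refine ⟨(dnfDAG f).compile, GateDAG.compile_isOver _ (dnfDAG_fn_mem f), ?_,
    (GateDAG.isSymmetricUnder_compile_iff _ Γ).2 (dnfDAG_isSymm f Γ hinv), fun x => ?_⟩
  · rw [Circuit.size, GateDAG.compile_gates_length]
    exact card_dnfGate_le f
  · rw [GateDAG.compile_eval, dnfDAG_evalOut]


end SymmetricDnf

/-- **Every invariant function has a symmetric circuit.** For `Γ`-invariant `f` on `m × m`
matrices, `HasSymCircuit tcBasis Γ (2 ^ (m * m) + m * m + 1) f` (the symmetric DNF; Jukna 2012,
§1.1 Eq. (1.1) for the DNF, Anderson–Dawar 2017, §2.2 for symmetry ⇒ invariance and its trivial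
converse at exponential size). [folklore] -/
theorem hasSymCircuit_of_invariant {m : ℕ} (f : (Fin m × Fin m → Bool) → Bool)
    (Γ : Set (Equiv.Perm (Fin m)))
    (hinv : ∀ ρ ∈ Γ, ∀ x : Fin m × Fin m → Bool, f (fun q => x (ρ q.1, ρ q.2)) = f x) :
    HasSymCircuit tcBasis Γ (2 ^ (m * m) + m * m + 1) f :=
  SymmetricDnf.hasSymCircuit_of_invariant f Γ hinv

/-- Hence the symmetric circuit complexity of an invariant function is attained by an actual
symmetric circuit (the infimum in `symCircuitSizeOver` is over a nonempty set). [folklore] -/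
theorem hasSymCircuit_symCircuitSizeOver_of_invariant {m : ℕ} (f : (Fin m × Fin m → Bool) → Bool)
    (Γ : Set (Equiv.Perm (Fin m)))
    (hinv : ∀ ρ ∈ Γ, ∀ x : Fin m × Fin m → Bool, f (fun q => x (ρ q.1, ρ q.2)) = f x) :
    HasSymCircuit tcBasis Γ (symCircuitSizeOver tcBasis Γ f) f := by
  obtain ⟨C, hB, -, hΓ, hf⟩ := hasSymCircuit_of_invariant f Γ hinv
  exact hasSymCircuit_symCircuitSizeOver ⟨C, hB, hΓ, hf⟩

/-- And it is at most `2 ^ (m * m) + m * m + 1`. [folklore] -/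
theorem symCircuitSizeOver_le_of_invariant {m : ℕ} (f : (Fin m × Fin m → Bool) → Bool)
    (Γ : Set (Equiv.Perm (Fin m)))
    (hinv : ∀ ρ ∈ Γ, ∀ x : Fin m × Fin m → Bool, f (fun q => x (ρ q.1, ρ q.2)) = f x) :
    symCircuitSizeOver tcBasis Γ f ≤ 2 ^ (m * m) + m * m + 1 := by
  obtain ⟨C, hB, hs, hΓ, hf⟩ := hasSymCircuit_of_invariant f Γ hinv
  exact (symCircuitSizeOver_le_of_computes C hB hΓ hf).trans hs

end Literature.Computability.Complexity
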